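import Literature.Probability.RandomPlanarGeometry.LoewnerLoopMassIncrement
import Literature.Probability.RandomPlanarGeometry.SLERestrictionCompensatorKappa
import Literature.Probability.RandomPlanarGeometry.LoewnerAliveMargin
import Literature.Probability.RandomPlanarGeometry.BrownianLoopMeasureProofs
import Mathlib.Analysis.Calculus.MeanValue
import Mathlib.MeasureTheory.Integral.IntervalIntegral.FundThmCalculus
import HarnessLib

/-!
# The loop mass collected by a growing Loewner hull: smallness, derivative and uniform bounds of the increments

Second file (after `LoewnerLoopMassIncrement`) of the deterministic form of the loop-mass identity
of G. F. Lawler, *Partition functions, loop measure, and versions of SLE*, J. Stat. Phys. **134**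
(2009) (**[Lawler2009]**), §2.2 (display before (4)): `Λ(A, K_t; ℍ) = 2 ∫₀ᵗ m(A_s − W_s) ds` in
the half-plane-capacity parametrisation, `m(B) = −SΦ_B(0)/6` (`starBubbleMass`). After the
increment identity `Λ(A, K_{s+u}; ℍ) = Λ(A, K_s; ℍ) + Λ(K^{W(s+·)−W(s)}_u, A_s − W_s; ℍ)`, the
printed proof (Lawler–Werner (2004), Thm. 12; Lawler (2005), Prop. 5.34) differentiates in `u`
with "the derivative of the loop measure is the bubble measure", Lawler (2005), **Prop. 5.30**:
`hcap(V_n)⁻¹ μ^loop(ℍ; ·, V_n) → μ^bub_ℍ(0; ·)` for hulls `V_n` shrinking to `0` — with Prop. 5.22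
(`μ^bub[hit B] = −SΦ_B(0)/6`) and `|μ^bub_ℍ(0; r)| = 1/r²` (§5.5). That proposition is NOT in the
tree; this file consumes it, read on Loewner hulls `K^{Uₙ}_{uₙ}` (`hcap = 2uₙ`), as the two
hypotheses

* `h530b`: for continuous drivers `Uₙ` with `Uₙ(0) = 0`, times `uₙ > 0`, `uₙ → 0`, hulls
  `K^{Uₙ}_{uₙ}` eventually inside every `B(0, ε)`, and `B ∈ 𝒬*`:
  `Λ(K^{Uₙ}_{uₙ}, B; ℍ)/(2uₙ) → starBubbleMass B`;
* `h530a`: for the same hulls and `r > 0`: `Λ(K^{Uₙ}_{uₙ}, {r ≤ |z|}; ℍ)/(2uₙ) → 1/r²`,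

and proves, for a continuous driver `W` and a nonempty `A ∈ 𝒬*`:

* `measurable_of_continuousWithinAt_Ici` — a right-continuous real function on `ℝ≥0` is measurable;
* `Loewner.exists_hull_incr_subset_ball` (+ sequence form) — the increment hulls
  `K^{W(s+·)−W(s)}_u`, `s ≤ t₁`, `u ≤ δ`, are uniformly small (uniform continuity of `W`, Lawler's
  Lemma 4.13 `hull_subset_closedBall_driving`);
* `Loewner.tendsto_loopMass_hull_incr_div` — `Λ(K^{W(s+·)−W(s)}_u, B; ℍ)/(2u) → m(B)` as `u ↓ 0`
  (`h530b`);
* `Loewner.loopMass_hull_lt_top`, `Loewner.exists_pos_le_norm_of_mem_slidHull` — finiteness of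
  `Λ(A, K_s; ℍ)` at alive times and the uniform margin `|z| ≥ r` on `A_s − W_s`, `s ≤ t₂`
  (`LoewnerAliveMargin`);
* `Loewner.exists_loopMass_hull_incr_le` — a uniform linear bound `Λ(K^{W(s+·)−W(s)}_u, A_s − W_s; ℍ) ≤ C u`
  for `s ≤ t₂`, `u ≤ δ` (`h530a` and monotonicity).

The identity itself is assembled in `LoewnerLoopMassIdentity`. No definition and no named fact
is introduced.

## References

* [Lawler2009] §2.2.
* G. F. Lawler, *Conformally Invariant Processes in the Plane* (2005), Lemma 4.13, §5.5, Prop. 5.22,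
  Prop. 5.30, Prop. 5.34. [Lawler2005]
* G. F. Lawler, W. Werner, PTRF 128 (2004), Prop. 11, Thm. 12. [LawlerWerner2004]
-/
noncomputable section

open Set Filter Topology MeasureTheory Metric
open UpperHalfPlane (upperHalfPlaneSet isOpen_upperHalfPlaneSet)
open scoped NNReal ENNReal

namespace Literature.Probability.RandomPlanarGeometry

open Loewner Literature.Probability.Process

/-! ### Right-continuous functions on `ℝ≥0` are measurable -/

/-- A real function on `ℝ≥0` which is right-continuous at every point is measurable (it is the
pointwise limit of its values at the dyadic upper approximations `(⌊2ⁿt⌋ + 1)/2ⁿ ↓ t`).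
[folklore] -/
theorem measurable_of_continuousWithinAt_Ici {g : ℝ≥0 → ℝ} (hg : ∀ t, ContinuousWithinAt g (Ici t) t) :
    Measurable g := by
  have hmeas : ∀ n : ℕ, Measurable fun t : ℝ≥0 ↦ g (dyadicCeil n t) := fun n ↦ by
    have h1 : Measurable fun t : ℝ≥0 ↦ ⌊t * 2 ^ n⌋₊ + 1 := (measurable_id.mul_const _).nat_floor.add_const 1
    have h2 : Measurable fun k : ℕ ↦ g (((k : ℕ) : ℝ≥0) / 2 ^ n) := measurable_from_nat
    exact h2.comp h1
  refine measurable_of_tendsto_metrizable hmeas (tendsto_pi_nhds.2 fun t ↦ ?_)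
  have h2 : Tendsto (fun n ↦ dyadicCeil n t) atTop (𝓝[Ici t] t) :=
    tendsto_nhdsWithin_of_tendsto_nhds_of_eventually_within _ (tendsto_dyadicCeil t)
      (Eventually.of_forall fun n ↦ (lt_dyadicCeil n t).le)
  exact (hg t).tendsto.comp h2

namespace Loewner

variable {W : ℝ≥0 → ℝ} {A : Set ℂ}

/-! ### The increment hulls `K^{W(s+·)−W(s)}_u` are uniformly small -/

/-- **Uniform smallness of the increment hulls**: for a continuous driver `W`, a horizon `t₁` and
`ε > 0` there is `δ > 0` with `K^{W(s+·)−W(s)}_u ⊆ B(0, ε)` for all `s ≤ t₁`, `u ≤ δ` (uniform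
continuity of `W` on `[0, t₁ + 1]` and `K_u ⊆ B̄(U_0, sup|U − U_0| + 4√u)`).
[cite: Lawler2005, Lemma 4.13] -/
theorem exists_hull_incr_subset_ball (hW : Continuous W) (t₁ : ℝ≥0) {ε : ℝ} (hε : 0 < ε) :
    ∃ δ : ℝ≥0, 0 < δ ∧ ∀ s ≤ t₁, ∀ u ≤ δ,
      hull (fun v ↦ W (s + v) - W s) u ⊆ ball (0 : ℂ) ε := by
  -- uniform continuity of `W` on `[0, t₁ + 1]`
  have huc : UniformContinuousOn W (Icc 0 (t₁ + 1)) :=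
    isCompact_Icc.uniformContinuousOn_of_continuous hW.continuousOn
  obtain ⟨δ₁, hδ₁, hmod⟩ := Metric.uniformContinuousOn_iff.1 huc (ε / 4) (by positivity)
  -- the step bound
  set δr : ℝ := min (δ₁ / 2) (min 1 ((ε / 16) ^ 2)) with hδr
  have hδr0 : 0 < δr := by positivity
  refine ⟨⟨δr, hδr0.le⟩, by exact_mod_cast hδr0, fun s hs u hu z hz ↦ ?_⟩
  have hu' : (u : ℝ) ≤ δr := by exact_mod_cast hu
  have hu1 : (u : ℝ) ≤ 1 := hu'.trans ((min_le_right _ _).trans (min_le_left _ _))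
  have huε : (u : ℝ) ≤ (ε / 16) ^ 2 := hu'.trans ((min_le_right _ _).trans (min_le_right _ _))
  have huδ : (u : ℝ) < δ₁ := lt_of_le_of_lt (hu'.trans (min_le_left _ _)) (by linarith)
  set U : ℝ≥0 → ℝ := fun v ↦ W (s + v) - W s with hU
  have hUc : Continuous U := (hW.comp (continuous_const.add continuous_id)).sub continuous_const
  have hU0 : U 0 = 0 := by simp [hU]
  have hosc : ∀ v : ℝ≥0, v ≤ u → |U v - U 0| ≤ ε / 4 := fun v hv ↦ by
    rw [hU0, sub_zero]
    have hsv : s + v ∈ Icc 0 (t₁ + 1) :=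
      ⟨zero_le, add_le_add hs (hv.trans (by exact_mod_cast hu1))⟩
    have hss : s ∈ Icc 0 (t₁ + 1) := ⟨zero_le, hs.trans le_self_add⟩
    have hdist : dist (s + v) s < δ₁ := by
      rw [NNReal.dist_eq]; push_cast
      rw [add_sub_cancel_left, abs_of_nonneg v.coe_nonneg]
      exact lt_of_le_of_lt (by exact_mod_cast hv) huδ
    have := hmod (s + v) hsv s hss hdist
    rw [Real.dist_eq] at this
    exact this.le
  have hsub := hull_subset_closedBall_driving hUc hosc hz
  rw [mem_closedBall, hU0, Complex.ofReal_zero] at hsub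
  rw [mem_ball]
  have hsqrt : Real.sqrt u ≤ ε / 16 := by
    rw [Real.sqrt_le_left (by positivity)]; exact huε
  linarith

/-- Sequence form: if `sₙ ≤ t₁` and `uₙ → 0`, the hulls `K^{W(sₙ+·)−W(sₙ)}_{uₙ}` eventually lie in
`B(0, ε)`. [cite: Lawler2005, Lemma 4.13] -/
theorem eventually_hull_incr_subset_ball (hW : Continuous W) {t₁ : ℝ≥0} {s : ℕ → ℝ≥0}
    (hs : ∀ n, s n ≤ t₁) {u : ℕ → ℝ≥0} (hu : Tendsto u atTop (𝓝 0)) {ε : ℝ} (hε : 0 < ε) :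
    ∀ᶠ n in atTop, hull (fun v ↦ W (s n + v) - W (s n)) (u n) ⊆ ball (0 : ℂ) ε := by
  obtain ⟨δ, hδ, h⟩ := exists_hull_incr_subset_ball hW t₁ hε
  filter_upwards [hu.eventually (Iic_mem_nhds hδ)] with n hn
  exact h (s n) (hs n) (u n) hn

/-! ### The right derivative of the increments: `Λ(K^{(s)}_u, B; ℍ)/(2u) → m(B)` -/

/-- **The right derivative of the increments** (Lawler's Prop. 5.30 with Prop. 5.22, hypothesis
`h530b`, along `u ↓ 0` for the increment hulls of a continuous driver at a fixed time `s` and a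
fixed `B ∈ 𝒬*`). [cite: Lawler2005, Prop. 5.30] -/
theorem tendsto_loopMass_hull_incr_div
    (h530b : ∀ (U : ℕ → ℝ≥0 → ℝ) (u : ℕ → ℝ≥0), (∀ n, Continuous (U n)) → (∀ n, U n 0 = 0) →
      (∀ n, 0 < u n) → Tendsto u atTop (𝓝 0) →
      (∀ ε : ℝ, 0 < ε → ∀ᶠ n in atTop, hull (U n) (u n) ⊆ ball (0 : ℂ) ε) →
      ∀ {B : Set ℂ}, IsStarHull B →
        Tendsto (fun n ↦ (loopMass upperHalfPlaneSet (hull (U n) (u n)) B).toReal / (2 * (u n : ℝ)))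
          atTop (𝓝 (starBubbleMass B)))
    (hW : Continuous W) {B : Set ℂ} (hB : IsStarHull B) (s : ℝ≥0) :
    Tendsto (fun u : ℝ≥0 ↦
        (loopMass upperHalfPlaneSet (hull (fun v ↦ W (s + v) - W s) u) B).toReal / (2 * (u : ℝ)))
      (𝓝[>] 0) (𝓝 (starBubbleMass B)) := by
  refine tendsto_of_seq_tendsto fun x hx ↦ ?_
  rw [tendsto_nhdsWithin_iff] at hx
  obtain ⟨hx0, hxpos⟩ := hx
  -- make the sequence positive everywhere (it is eventually)
  classical
  set u : ℕ → ℝ≥0 := fun n ↦ if 0 < x n then x n else 1 with hudef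
  have hux : u =ᶠ[atTop] x := by
    filter_upwards [hxpos] with n hn
    simp [hudef, show 0 < x n from hn]
  have hupos : ∀ n, 0 < u n := fun n ↦ by
    simp only [hudef]; split_ifs with h
    · exact h
    · exact one_pos
  have hu0 : Tendsto u atTop (𝓝 0) := hx0.congr' hux.symm
  have hUc : Continuous fun v ↦ W (s + v) - W s :=
    (hW.comp (continuous_const.add continuous_id)).sub continuous_const
  have hsmall : ∀ ε : ℝ, 0 < ε → ∀ᶠ n in atTop, hull (fun v ↦ W (s + v) - W s) (u n) ⊆ ball (0 : ℂ) ε :=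
    fun ε hε ↦ eventually_hull_incr_subset_ball hW (s := fun _ ↦ s) (fun _ ↦ le_rfl) hu0 hε
  have h := h530b (fun _ ↦ fun v ↦ W (s + v) - W s) u (fun _ ↦ hUc) (fun _ ↦ by simp) hupos hu0 hsmall hB
  refine h.congr' ?_
  filter_upwards [hux] with n hn
  simp only [Function.comp_apply, hn]

/-! ### The margin `dist(0, A_s − W_s) > 0` up to an alive time, and finiteness -/

/-- The open upper half-plane misses the disc `B(−2i, 1)`, so its boundary is nonpolar in the
sense used by `loopMass_lt_top`. [folklore] -/
theorem exists_ball_disjoint_upperHalfPlaneSet :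
    ∃ z₀ : ℂ, ∃ ρ : ℝ, 0 < ρ ∧ Disjoint (ball z₀ ρ) upperHalfPlaneSet := by
  refine ⟨-2 * Complex.I, 1, one_pos, disjoint_left.2 fun w hw hw' ↦ ?_⟩
  have h1 : ‖w - (-2 * Complex.I)‖ < 1 := by rwa [mem_ball, dist_eq_norm] at hw
  have h2 : |(w - (-2 * Complex.I)).im| < 1 := lt_of_le_of_lt (Complex.abs_im_le_norm _) h1
  have h3 : (w - (-2 * Complex.I)).im = w.im + 2 := by simp
  rw [h3, abs_lt] at h2
  have h4 : 0 < w.im := hw'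
  linarith [h2.2]

/-- A compact set and a closed set which are disjoint are at positive distance. [folklore] -/
theorem exists_pos_forall_le_dist {K F : Set ℂ} (hK : IsCompact K) (hF : IsClosed F)
    (h : Disjoint K F) : ∃ δ : ℝ, 0 < δ ∧ ∀ x ∈ K, ∀ y ∈ F, δ ≤ dist x y := by
  obtain ⟨r, hr, hxy⟩ := Metric.exists_pos_forall_lt_edist hK hF h
  refine ⟨r, NNReal.coe_pos.2 hr, fun x hx y hy ↦ ?_⟩
  have := hxy x hx y hy
  rw [edist_dist, ← ENNReal.ofReal_coe_nnreal, ENNReal.ofReal_lt_ofReal_iff_of_nonneg NNReal.zero_le_coe] at this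
  exact this.le

/-- **`Λ(A, K_s; ℍ) < ∞` at an alive time** (`A` compact, `K_s ⊆ K̄_s` compact and disjoint from
`A`, so at positive distance; `loopMass_lt_top_holds`). [cite: Lawler2009, §2.2 (finiteness of Λ)] -/
theorem loopMass_hull_lt_top (hW : Continuous W) (hA : IsStarHull A) {s : ℝ≥0}
    (halive : Disjoint (closedHull W s) A) : loopMass upperHalfPlaneSet A (hull W s) < ∞ := by
  obtain ⟨δ, hδ, hsep⟩ := exists_pos_forall_le_dist hA.isBoundedHull.isCompact (isClosed_closedHull hW s) halive.symm
  exact loopMass_lt_top_holds isOpen_upperHalfPlaneSet exists_ball_disjoint_upperHalfPlaneSet hA.isBoundedHull.1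
    ⟨δ, hδ, fun x hx y hy ↦ hsep x hx y (hull_subset_closedHull W s hy)⟩

/-- **Uniform margin up to an alive time**: if `A ∈ 𝒬*` (nonempty) is alive at `t₂`, there is
`r > 0` with `|z| ≥ r` for every `z ∈ A_s − W_s`, `s ≤ t₂` (continuity of `s ↦ dist(0, A_s − W_s)`
on `[0, T_A)`, `LoewnerAliveMargin`, and positivity at each alive time).
[cite: LawlerSchrammWerner2003Restriction, §5 (t < T)] -/
theorem exists_pos_le_norm_of_mem_slidHull (hW : Continuous W) (hA : IsStarHull A) (hne : A.Nonempty)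
    {t₂ : ℝ≥0} (halive : Disjoint (closedHull W t₂) A) :
    ∃ r : ℝ, 0 < r ∧ ∀ s ≤ t₂, ∀ z ∈ slidHull W A s, r ≤ ‖z‖ := by
  have hal : ∀ s ≤ t₂, Disjoint (closedHull W s) A := fun s hs ↦ halive.mono_left (closedHull_mono W hs)
  have hcont : ContinuousOn (fun t : ℝ≥0 ↦ infDist 0 (slidHull W A t)) (Icc 0 t₂) :=
    (continuousOn_infDist_slidHull hW hA hne).mono fun s hs ↦
      (disjoint_closedHull_iff_lt_hullHitTime hW hA hne).1 (hal s hs.2)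
  obtain ⟨s₀, hs₀, hmin⟩ := isCompact_Icc.exists_isMinOn (nonempty_Icc.2 (zero_le (a := t₂))) hcont
  have hB₀ : IsStarHull (slidHull W A s₀) := isStarHull_slidHull_of_disjoint hW hA (hal s₀ hs₀.2)
  have hne₀ : (slidHull W A s₀).Nonempty := hne.image _
  have hr : 0 < infDist 0 (slidHull W A s₀) :=
    (hB₀.isBoundedHull.isClosed.notMem_iff_infDist_pos hne₀).1 hB₀.zero_notMem
  refine ⟨infDist 0 (slidHull W A s₀), hr, fun s hs z hz ↦ ?_⟩
  have h1 : infDist 0 (slidHull W A s₀) ≤ infDist 0 (slidHull W A s) := hmin ⟨zero_le, hs⟩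
  have h2 : infDist 0 (slidHull W A s) ≤ dist 0 z := infDist_le_dist_of_mem hz
  rw [dist_comm, dist_zero_right] at h2
  exact h1.trans h2

/-! ### A uniform linear bound on the increments up to an alive time -/

/-- **Uniform linear bound on the increments** (Lawler's Prop. 5.30, total-mass form `h530a`):
if `A ∈ 𝒬*` (nonempty) is alive at `t₂`, there are `C` and `δ > 0` with
`Λ(K^{W(s+·)−W(s)}_u, A_s − W_s; ℍ) ≤ C u` for all `s ≤ t₂`, `u ≤ δ`. (Monotonicity: `A_s − W_s`
lies outside `B(0, r)`, so the increment is at most the mass of the loops from the small hull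
reaching `{|z| ≥ r}`, which is `(2u/r²)(1 + o(1))` uniformly — a violating sequence would
contradict `h530a`.) [cite: Lawler2005, Prop. 5.30] -/
theorem exists_loopMass_hull_incr_le
    (h530a : ∀ (U : ℕ → ℝ≥0 → ℝ) (u : ℕ → ℝ≥0), (∀ n, Continuous (U n)) → (∀ n, U n 0 = 0) →
      (∀ n, 0 < u n) → Tendsto u atTop (𝓝 0) →
      (∀ ε : ℝ, 0 < ε → ∀ᶠ n in atTop, hull (U n) (u n) ⊆ ball (0 : ℂ) ε) →
      ∀ {r : ℝ}, 0 < r →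
        Tendsto (fun n ↦ (loopMass upperHalfPlaneSet (hull (U n) (u n)) {z : ℂ | r ≤ ‖z‖}).toReal /
          (2 * (u n : ℝ))) atTop (𝓝 (1 / r ^ 2)))
    (hW : Continuous W) (hA : IsStarHull A) (hne : A.Nonempty) {t₂ : ℝ≥0}
    (halive : Disjoint (closedHull W t₂) A) :
    ∃ C δ : ℝ, 0 < δ ∧ ∀ s ≤ t₂, ∀ u : ℝ≥0, (u : ℝ) ≤ δ →
      loopMass upperHalfPlaneSet (hull (fun v ↦ W (s + v) - W s) u) (slidHull W A s) ≤
        ENNReal.ofReal (C * u) := by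
  obtain ⟨r, hr, hrle⟩ := exists_pos_le_norm_of_mem_slidHull hW hA hne halive
  obtain ⟨δ₀, hδ₀, hsmall⟩ := exists_hull_incr_subset_ball hW t₂ (half_pos hr)
  set E : Set ℂ := {z : ℂ | r ≤ ‖z‖} with hE
  -- monotone comparison with the loops reaching `{|z| ≥ r}`, and finiteness of the latter
  have hmono : ∀ s ≤ t₂, ∀ u : ℝ≥0,
      loopMass upperHalfPlaneSet (hull (fun v ↦ W (s + v) - W s) u) (slidHull W A s) ≤
        loopMass upperHalfPlaneSet (hull (fun v ↦ W (s + v) - W s) u) E :=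
    fun s hs u ↦ loopMass_mono subset_rfl fun z hz ↦ hrle s hs z hz
  have hfin : ∀ s ≤ t₂, ∀ u ≤ δ₀, loopMass upperHalfPlaneSet (hull (fun v ↦ W (s + v) - W s) u) E < ∞ := by
    intro s hs u hu
    have hsub := hsmall s hs u hu
    refine loopMass_lt_top_holds isOpen_upperHalfPlaneSet exists_ball_disjoint_upperHalfPlaneSet
      (isBounded_ball.subset hsub) ⟨r / 2, half_pos hr, fun x hx y hy ↦ ?_⟩
    have hx' : ‖x‖ < r / 2 := by simpa using hsub hx
    have hy' : r ≤ ‖y‖ := hy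
    have := norm_sub_norm_le y x
    rw [← dist_eq_norm, dist_comm] at this
    linarith
  -- contradiction with `h530a` along a violating sequence
  by_contra hneg
  push Not at hneg
  have hviol : ∀ n : ℕ, ∃ s : ℝ≥0, ∃ u : ℝ≥0, s ≤ t₂ ∧ (u : ℝ) ≤ min (δ₀ : ℝ) (1 / ((n : ℝ) + 1)) ∧
      ENNReal.ofReal (((n : ℝ) + 1) * u) <
        loopMass upperHalfPlaneSet (hull (fun v ↦ W (s + v) - W s) u) (slidHull W A s) := fun n ↦ by
    obtain ⟨s, hs, u, hu, hlt⟩ := hneg ((n : ℝ) + 1) (min (δ₀ : ℝ) (1 / ((n : ℝ) + 1))) (by positivity)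
    exact ⟨s, u, hs, hu, hlt⟩
  choose s u hs hu hlt using hviol
  have huδ : ∀ n, u n ≤ δ₀ := fun n ↦ by
    have := (hu n).trans (min_le_left _ _)
    exact_mod_cast this
  have hupos : ∀ n, 0 < u n := fun n ↦ by
    by_contra h0
    have hu0 : u n = 0 := le_antisymm (not_lt.1 h0) zero_le
    have hUc : Continuous fun v ↦ W (s n + v) - W (s n) :=
      (hW.comp (continuous_const.add continuous_id)).sub continuous_const
    have := hlt n
    rw [hu0, hull_zero_holds hUc, loopMass_empty_left] at this
    exact absurd this (not_lt.2 bot_le)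
  have hu0 : Tendsto u atTop (𝓝 0) := by
    rw [← NNReal.tendsto_coe]
    refine squeeze_zero (fun n ↦ (u n).coe_nonneg) (fun n ↦ (hu n).trans (min_le_right _ _)) ?_
    exact tendsto_one_div_add_atTop_nhds_zero_nat
  have hconv := h530a (fun n ↦ fun v ↦ W (s n + v) - W (s n)) u
    (fun n ↦ (hW.comp (continuous_const.add continuous_id)).sub continuous_const) (fun n ↦ by simp)
    hupos hu0 (fun ε hε ↦ eventually_hull_incr_subset_ball hW hs hu0 hε) hr
  -- along the sequence the normalised masses exceed `(n+1)/2`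
  have hbig : ∀ n : ℕ, ((n : ℝ) + 1) / 2 <
      (loopMass upperHalfPlaneSet (hull (fun v ↦ W (s n + v) - W (s n)) (u n)) E).toReal / (2 * (u n : ℝ)) := by
    intro n
    have hfinn := hfin (s n) (hs n) (u n) (huδ n)
    have h1 : ENNReal.ofReal (((n : ℝ) + 1) * u n) <
        loopMass upperHalfPlaneSet (hull (fun v ↦ W (s n + v) - W (s n)) (u n)) E :=
      lt_of_lt_of_le (hlt n) (hmono (s n) (hs n) (u n))
    have h2 : ((n : ℝ) + 1) * u n <
        (loopMass upperHalfPlaneSet (hull (fun v ↦ W (s n + v) - W (s n)) (u n)) E).toReal :=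
      (ENNReal.ofReal_lt_iff_lt_toReal (by positivity) hfinn.ne).1 h1
    have hun : (0 : ℝ) < u n := by exact_mod_cast hupos n
    rw [lt_div_iff₀ (by positivity)]
    nlinarith
  -- while they converge to `1/r²`: contradiction
  have hev : ∀ᶠ n in atTop,
      (loopMass upperHalfPlaneSet (hull (fun v ↦ W (s n + v) - W (s n)) (u n)) E).toReal / (2 * (u n : ℝ)) <
        1 / r ^ 2 + 1 := hconv.eventually (Iio_mem_nhds (lt_add_one _))
  obtain ⟨N, hN⟩ := exists_nat_gt (2 * (1 / r ^ 2 + 1))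
  obtain ⟨n, hn, hnN⟩ := (hev.and (eventually_ge_atTop N)).exists
  have h1 := hbig n
  have h2 : (N : ℝ) ≤ n := by exact_mod_cast hnN
  linarith

end Loewner

end Literature.Probability.RandomPlanarGeometry

end
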